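import Summits.QuantumFields.YangMills.Theorems.ScalingWindowSplitSelfNormalisedSkewnessStubTorusGreenThirdDiffOneDim
import Summits.QuantumFields.YangMills.Theorems.ScalingWindowSplitSelfNormalisedSkewnessStubTorusGreenThirdDiffProduct
import HarnessLib

/-!
# Crux `SelfNormalisedSkewness` (stmt-QuantumFields-18944), line `Sketch`: stub `stub_torusGreenThirdDiff`

Third differences of the zero-mode-removed Green function `G̃_L = torusGreen` of `(ℤ/Lℤ)⁴` decay
like `dist⁻⁵`, uniformly in the period, up to the `L⁻⁴` background of the removed zero mode:
`|Hess_{ij}(z) - Hess_{ij}(z - e_k)| ≤ C (dist(0,z)⁻⁵ + L⁻⁴)` for `z ≠ 0`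
(`Hess_{ij}(z) = G̃(z+eᵢ) - G̃(z+eᵢ-eⱼ) - G̃(z) + G̃(z-eⱼ)`, `dist² = ∑_μ z̃_μ²`). Proof: the
heat-kernel representation `torusGreen_hessian_eq` at `z` and `z - e_k` with `S = L²`; the two
Fourier tails are `≤ (π²/2) C₀⁴ L⁻⁴` (`abs_torusGreen_hessian_tail_le`); the difference of the
heat-kernel parts is the time integral of the third difference of the product heat kernel,
`≤ K (1∨s)^{-1/2} ((1∨s) + M²)⁻³`, `M = max_μ |z̃_μ| ≥ 1` (`abs_thirdDiff_hessian_prod_torusHeatKernel_le`,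
from the companion files `…OneDim`, `…Product`), whose time integral is `≤ 3 M⁻⁵`; `dist ≤ 2M`.
No named facts are used (folklore heat-kernel calculus, cf. Lawler–Limic 2010, §2.3 and §6.3).
-/

noncomputable section

open MeasureTheory Set Filter Finset ZMod intervalIntegral
open scoped Real Topology BigOperators ComplexConjugate
open Literature.Probability.LatticeModels

namespace Summit.QuantumFields.YangMills.Theorems.SelfNormalisedSkewness.Negative

/-! ### The third difference of the product heat kernel in `d = 4` -/

/-- **Third difference of the product heat kernel of `(ℤ/Lℤ)⁴`.** There is `K > 0` such that for
all `L ≥ 1`, `0 < s ≤ L²`, `z ∈ (ℤ/Lℤ)⁴`, all `i, j, k` and every coordinate `μ₀`,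
`|∇ᵢ⁺∇ⱼ⁻[∏_μ q^L_s](z) - ∇ᵢ⁺∇ⱼ⁻[∏_μ q^L_s](z - e_k)| ≤ K (1∨s)^{-1/2} ((1∨s) + z̃_{μ₀}²)⁻³`
(`z̃ = valMinAbs`): the backward difference in `k` costs one more factor `(1∨s)^{-1/2}` than the
Hessian bound `abs_hessian_prod_torusHeatKernel_le`. [folklore] -/
theorem abs_thirdDiff_hessian_prod_torusHeatKernel_le : ∃ K : ℝ, 0 < K ∧ ∀ (L : ℕ) [NeZero L]
    (s : ℝ), 0 < s → s ≤ (L : ℝ) ^ 2 → ∀ (z : TorusSite 4 L) (i j k μ₀ : Fin 4),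
      |((∏ μ, torusHeatKernel s ((z + Pi.single i 1 : TorusSite 4 L) μ)) -
          (∏ μ, torusHeatKernel s ((z + Pi.single i 1 - Pi.single j 1 : TorusSite 4 L) μ)) -
          (∏ μ, torusHeatKernel s (z μ)) +
          ∏ μ, torusHeatKernel s ((z - Pi.single j 1 : TorusSite 4 L) μ)) -
        ((∏ μ, torusHeatKernel s ((z - Pi.single k 1 + Pi.single i 1 : TorusSite 4 L) μ)) -
          (∏ μ, torusHeatKernel s
            ((z - Pi.single k 1 + Pi.single i 1 - Pi.single j 1 : TorusSite 4 L) μ)) -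
          (∏ μ, torusHeatKernel s ((z - Pi.single k 1 : TorusSite 4 L) μ)) +
          ∏ μ, torusHeatKernel s ((z - Pi.single k 1 - Pi.single j 1 : TorusSite 4 L) μ))| ≤
        K * (max 1 s) ^ (-(1 / 2 : ℝ)) * ((max 1 s + ((z μ₀).valMinAbs : ℝ) ^ 2) ^ 3)⁻¹ := by
  obtain ⟨K₀, hK₀, h₀⟩ := abs_torusHeatKernel_le
  obtain ⟨K₁, hK₁, h₁⟩ := abs_torusHeatKernel_fwdDiff_le
  obtain ⟨K₂, hK₂, h₂⟩ := abs_torusHeatKernel_bwdDiff_le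
  obtain ⟨K₃, hK₃, h₃⟩ := abs_torusHeatKernel_sndDiff_le
  obtain ⟨K₄, hK₄, h₄⟩ := abs_torusHeatKernel_sndDiff_shift_le
  obtain ⟨K₅, hK₅, h₅⟩ := abs_torusHeatKernel_thirdDiff_le
  set K : ℝ := max (max (max K₀ K₁) (max K₂ K₃)) (max K₄ K₅) with hK
  have hK0 : K₀ ≤ K := ((le_max_left _ _).trans (le_max_left _ _)).trans (le_max_left _ _)
  have hK1 : K₁ ≤ K := ((le_max_right _ _).trans (le_max_left _ _)).trans (le_max_left _ _)
  have hK2 : K₂ ≤ K := ((le_max_left _ _).trans (le_max_right _ _)).trans (le_max_left _ _)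
  have hK3 : K₃ ≤ K := ((le_max_right _ _).trans (le_max_right _ _)).trans (le_max_left _ _)
  have hK4 : K₄ ≤ K := (le_max_left _ _).trans (le_max_right _ _)
  have hK5 : K₅ ≤ K := (le_max_right _ _).trans (le_max_right _ _)
  have hKpos : 0 < K := hK₀.trans_le hK0
  refine ⟨K ^ 4, by positivity, ?_⟩
  intro L _ s hs hsL z i j k μ₀
  set T : ℝ := max 1 s with hT
  have hT1 : 1 ≤ T := le_max_left _ _
  have hT0 : 0 < T := by positivity
  set σ : ℝ := T ^ (-(1 / 2 : ℝ)) with hσ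
  have hσ0 : 0 < σ := Real.rpow_pos_of_pos hT0 _
  have hσσ : σ * σ = T⁻¹ := max_one_rpow_neg_half_mul_self s
  have hσ2 : σ ^ 2 = T⁻¹ := by rw [sq, hσσ]
  have hσ3 : σ ^ 3 = T⁻¹ * σ := by rw [pow_succ, hσ2]
  have hσ4 : σ ^ 4 = T⁻¹ * T⁻¹ := by rw [show σ ^ 4 = σ ^ 2 * σ ^ 2 by ring, hσ2]
  -- the Gaussian weight
  set W : ZMod L → ℝ := fun m => ((1 + (m.valMinAbs : ℝ) ^ 2 / T) ^ 3)⁻¹ with hW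
  have hW0 : ∀ m, 0 ≤ W m := fun m => by positivity
  have hW1 : ∀ m, W m ≤ 1 := fun m => by
    rw [hW]
    exact inv_le_one_of_one_le₀ (one_le_pow₀ (by
      have : 0 ≤ (m.valMinAbs : ℝ) ^ 2 / T := by positivity
      linarith))
  -- the one-dimensional bounds with the common constant `K`
  have b₀ : ∀ m : ZMod L, |torusHeatKernel s m| ≤ K * σ * W m := fun m =>
    (h₀ L s hs hsL m).trans (by gcongr)
  have b₁ : ∀ m : ZMod L, |torusHeatKernel s (m + 1) - torusHeatKernel s m| ≤
      K * σ ^ 2 * W m := fun m => by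
    rw [hσ2]; exact (h₁ L s hs hsL m).trans (by gcongr)
  have b₂ : ∀ m : ZMod L, |torusHeatKernel s m - torusHeatKernel s (m - 1)| ≤
      K * σ ^ 2 * W m := fun m => by
    rw [hσ2]; exact (h₂ L s hs hsL m).trans (by gcongr)
  have b₃ : ∀ m : ZMod L, |torusHeatKernel s (m + 1) - 2 * torusHeatKernel s m +
      torusHeatKernel s (m - 1)| ≤ K * σ ^ 3 * W m := fun m => by
    rw [hσ3]; exact (h₃ L s hs hsL m).trans (by gcongr)
  have b₄ : ∀ m : ZMod L, |torusHeatKernel s m - 2 * torusHeatKernel s (m - 1) +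
      torusHeatKernel s (m - 2)| ≤ K * σ ^ 3 * W m := fun m => by
    rw [hσ3]; exact (h₄ L s hs hsL m).trans (by gcongr)
  have b₅ : ∀ m : ZMod L, |torusHeatKernel s (m + 1) - 3 * torusHeatKernel s m +
      3 * torusHeatKernel s (m - 1) - torusHeatKernel s (m - 2)| ≤ K * σ ^ 4 * W m := fun m => by
    rw [hσ4]; exact (h₅ L s hs hsL m).trans (by gcongr)
  -- the coordinate kernels `Q` and their amplitudes `a`
  obtain ⟨Q, hQ⟩ : ∃ Q : Fin 4 → ZMod L → ℝ, Q = fun μ m =>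
      if μ = k then torusHeatKernel s m - torusHeatKernel s (m - 1) else torusHeatKernel s m :=
    ⟨_, rfl⟩
  obtain ⟨a, ha⟩ : ∃ a : Fin 4 → ℝ, a = fun μ => if μ = k then K * σ else K := ⟨_, rfl⟩
  have hQk : ∀ m, Q k m = torusHeatKernel s m - torusHeatKernel s (m - 1) := fun m => by
    simp [hQ]
  have hQne : ∀ μ, μ ≠ k → ∀ m, Q μ m = torusHeatKernel s m := fun μ hμ m => by simp [hQ, hμ]
  have hak : a k = K * σ := by simp [ha]
  have hane : ∀ μ, μ ≠ k → a μ = K := fun μ hμ => by simp [ha, hμ]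
  have ha0 : ∀ μ, 0 ≤ a μ := fun μ => by
    by_cases hμ : μ = k
    · rw [hμ, hak]; positivity
    · rw [hane μ hμ]; positivity
  have H0 : ∀ μ m, |Q μ m| ≤ a μ * σ * W m := by
    intro μ m
    by_cases hμ : μ = k
    · rw [hμ, hQk, hak]
      calc _ ≤ K * σ ^ 2 * W m := b₂ m
        _ = K * σ * σ * W m := by ring
    · rw [hQne μ hμ, hane μ hμ]; exact b₀ m
  have H1 : ∀ μ m, |Q μ (m + 1) - Q μ m| ≤ a μ * σ ^ 2 * W m := by
    intro μ m
    by_cases hμ : μ = k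
    · rw [hμ, hQk, hQk, hak, add_sub_cancel_right,
        show torusHeatKernel s (m + 1) - torusHeatKernel s m -
          (torusHeatKernel s m - torusHeatKernel s (m - 1)) =
          torusHeatKernel s (m + 1) - 2 * torusHeatKernel s m + torusHeatKernel s (m - 1) by ring]
      calc _ ≤ K * σ ^ 3 * W m := b₃ m
        _ = K * σ * σ ^ 2 * W m := by ring
    · rw [hQne μ hμ, hQne μ hμ, hane μ hμ]; exact b₁ m
  have H2 : ∀ μ m, |Q μ m - Q μ (m - 1)| ≤ a μ * σ ^ 2 * W m := by
    intro μ m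
    by_cases hμ : μ = k
    · rw [hμ, hQk, hQk, hak, show (m - 1 - 1 : ZMod L) = m - 2 by ring,
        show torusHeatKernel s m - torusHeatKernel s (m - 1) -
          (torusHeatKernel s (m - 1) - torusHeatKernel s (m - 2)) =
          torusHeatKernel s m - 2 * torusHeatKernel s (m - 1) + torusHeatKernel s (m - 2) by ring]
      calc _ ≤ K * σ ^ 3 * W m := b₄ m
        _ = K * σ * σ ^ 2 * W m := by ring
    · rw [hQne μ hμ, hQne μ hμ, hane μ hμ]; exact b₂ m
  have H3 : ∀ μ m, |Q μ (m + 1) - 2 * Q μ m + Q μ (m - 1)| ≤ a μ * σ ^ 3 * W m := by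
    intro μ m
    by_cases hμ : μ = k
    · rw [hμ, hQk, hQk, hQk, hak, add_sub_cancel_right, show (m - 1 - 1 : ZMod L) = m - 2 by ring,
        show torusHeatKernel s (m + 1) - torusHeatKernel s m -
          2 * (torusHeatKernel s m - torusHeatKernel s (m - 1)) +
          (torusHeatKernel s (m - 1) - torusHeatKernel s (m - 2)) =
          torusHeatKernel s (m + 1) - 3 * torusHeatKernel s m + 3 * torusHeatKernel s (m - 1) -
            torusHeatKernel s (m - 2) by ring]
      calc _ ≤ K * σ ^ 4 * W m := b₅ m
        _ = K * σ * σ ^ 3 * W m := by ring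
    · rw [hQne μ hμ, hQne μ hμ, hQne μ hμ, hane μ hμ]; exact b₃ m
  -- assemble
  rw [thirdDiff_prod_eq (torusHeatKernel s) Q k hQk hQne z i j]
  have hmain := abs_hessian_prodKernel_le Q a σ W ha0 hσ0.le hW0 hW1 H0 H1 H2 H3 z i j μ₀
  have hpa : ∏ μ, a μ = K ^ 4 * σ := by
    rw [← Finset.mul_prod_erase _ a (Finset.mem_univ k), hak]
    have : ∏ μ ∈ (univ : Finset (Fin 4)).erase k, a μ = ∏ _μ ∈ (univ : Finset (Fin 4)).erase k, K :=
      Finset.prod_congr rfl fun μ hμ => hane μ (Finset.ne_of_mem_erase hμ)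
    rw [this, Finset.prod_const, Finset.card_erase_of_mem (Finset.mem_univ k), Finset.card_univ,
      Fintype.card_fin]
    ring
  have hTm : T + ((z μ₀).valMinAbs : ℝ) ^ 2 ≠ 0 := by positivity
  have htarget : σ ^ 6 * W (z μ₀) = ((T + ((z μ₀).valMinAbs : ℝ) ^ 2) ^ 3)⁻¹ := by
    rw [show σ ^ 6 = σ ^ 2 * σ ^ 2 * σ ^ 2 by ring, hσ2, hW]
    field_simp
  calc _ ≤ (∏ μ, a μ) * σ ^ 6 * W (z μ₀) := hmain
    _ = K ^ 4 * σ * ((T + ((z μ₀).valMinAbs : ℝ) ^ 2) ^ 3)⁻¹ := by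
        rw [hpa, mul_assoc, htarget]


/-! ### Time integrals -/

/-- `∫₀^A s^{-1/2} ds = 2 √A`. [folklore] -/
theorem integral_rpow_neg_half (A : ℝ) :
    ∫ s in (0 : ℝ)..A, s ^ (-(1 / 2 : ℝ)) = 2 * Real.sqrt A := by
  rw [integral_rpow (Or.inl (by norm_num)), show (-(1 / 2 : ℝ) + 1) = 1 / 2 by norm_num,
    Real.zero_rpow (by norm_num), sub_zero, Real.sqrt_eq_rpow]
  ring

/-- `∫_a^b ((s + c)³)⁻¹ ds ≤ (a + c)⁻²/2` for `a + c > 0`, `a ≤ b`. [folklore] -/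
theorem integral_inv_add_cube_le' {a b c : ℝ} (hac : 0 < a + c) (hab : a ≤ b) :
    ∫ s in a..b, ((s + c) ^ 3)⁻¹ ≤ ((a + c) ^ 2)⁻¹ / 2 := by
  have hzpow : ∀ u : ℝ, (u ^ 3)⁻¹ = u ^ (-3 : ℤ) := fun u => by
    rw [show (-3 : ℤ) = -((3 : ℕ) : ℤ) by norm_num, zpow_neg, zpow_natCast]
  rw [intervalIntegral.integral_comp_add_right (fun u : ℝ => (u ^ 3)⁻¹) c]
  simp_rw [hzpow]
  have h0 : (0 : ℝ) ∉ Set.uIcc (a + c) (b + c) := by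
    rw [Set.uIcc_of_le (by linarith)]
    intro h
    exact absurd h.1 (not_le.2 hac)
  rw [integral_zpow (Or.inr ⟨by norm_num, h0⟩)]
  have e1 : (-3 : ℤ) + 1 = -((2 : ℕ) : ℤ) := by norm_num
  have h2 : (b + c) ^ ((-3 : ℤ) + 1) = ((b + c) ^ 2)⁻¹ := by rw [e1, zpow_neg, zpow_natCast]
  have h3 : (a + c) ^ ((-3 : ℤ) + 1) = ((a + c) ^ 2)⁻¹ := by rw [e1, zpow_neg, zpow_natCast]
  rw [h2, h3]
  have hpos : 0 ≤ ((b + c) ^ 2)⁻¹ := by positivity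
  norm_num
  rw [div_neg]
  linarith

/-- The bound `s ↦ (1∨s)^{-1/2} ((1∨s) + M²)⁻³` is continuous. [folklore] -/
theorem continuous_thirdDiff_weight (M : ℝ) :
    Continuous fun s : ℝ => (max 1 s) ^ (-(1 / 2 : ℝ)) * ((max 1 s + M ^ 2) ^ 3)⁻¹ := by
  have h1 : Continuous fun s : ℝ => max 1 s := continuous_const.max continuous_id
  have h2 : ∀ s : ℝ, (max 1 s + M ^ 2) ^ 3 ≠ 0 := fun s => by positivity
  have h3 : Continuous fun s : ℝ => ((max 1 s + M ^ 2) ^ 3)⁻¹ := Continuous.inv₀ (by fun_prop) h2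
  exact (h1.rpow_const fun s => Or.inl (by positivity)).mul h3

/-- **The time integral of the third-difference bound**: for `M ≥ 1` and `M² ≤ S`,
`∫₀^S (1∨s)^{-1/2} ((1∨s) + M²)⁻³ ds ≤ 3 M⁻⁵` (`≤ s^{-1/2} M⁻⁶` on `[0, M²]`, integral `2M⁻⁵`;
`≤ M⁻¹ (s + M²)⁻³` on `[M², S]`, integral `≤ M⁻⁵/8`). [folklore] -/
theorem integral_thirdDiff_weight_le {M S : ℝ} (hM : 1 ≤ M) (hMS : M ^ 2 ≤ S) :
    ∫ s in (0 : ℝ)..S, (max 1 s) ^ (-(1 / 2 : ℝ)) * ((max 1 s + M ^ 2) ^ 3)⁻¹ ≤ 3 * (M ^ 5)⁻¹ := by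
  have hM0 : 0 < M := by linarith
  have hM20 : 0 < M ^ 2 := by positivity
  have hcont := continuous_thirdDiff_weight M
  rw [← intervalIntegral.integral_add_adjacent_intervals (b := M ^ 2)
    (hcont.intervalIntegrable _ _) (hcont.intervalIntegrable _ _)]
  -- `[0, M²]`
  have h1 : ∫ s in (0 : ℝ)..M ^ 2, (max 1 s) ^ (-(1 / 2 : ℝ)) * ((max 1 s + M ^ 2) ^ 3)⁻¹ ≤
      2 * (M ^ 5)⁻¹ := by
    calc _ ≤ ∫ s in (0 : ℝ)..M ^ 2, (M ^ 6)⁻¹ * s ^ (-(1 / 2 : ℝ)) := by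
          refine intervalIntegral.integral_mono_on_of_le_Ioo hM20.le (hcont.intervalIntegrable _ _)
            ((intervalIntegral.intervalIntegrable_rpow' (by norm_num)).const_mul _) fun s hs => ?_
          have hs0 : 0 < s := hs.1
          have hrpow : (max 1 s) ^ (-(1 / 2 : ℝ)) ≤ s ^ (-(1 / 2 : ℝ)) :=
            Real.rpow_le_rpow_of_nonpos hs0 (le_max_right _ _) (by norm_num)
          have hcube : ((max 1 s + M ^ 2) ^ 3)⁻¹ ≤ (M ^ 6)⁻¹ := by
            apply inv_anti₀ (by positivity)
            rw [show M ^ 6 = (M ^ 2) ^ 3 by ring]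
            exact pow_le_pow_left₀ hM20.le (by linarith [le_max_left (1 : ℝ) s]) 3
          calc (max 1 s) ^ (-(1 / 2 : ℝ)) * ((max 1 s + M ^ 2) ^ 3)⁻¹
              ≤ s ^ (-(1 / 2 : ℝ)) * (M ^ 6)⁻¹ :=
                mul_le_mul hrpow hcube (by positivity) (Real.rpow_nonneg hs0.le _)
            _ = (M ^ 6)⁻¹ * s ^ (-(1 / 2 : ℝ)) := mul_comm _ _
      _ = (M ^ 6)⁻¹ * (2 * Real.sqrt (M ^ 2)) := by
          rw [intervalIntegral.integral_const_mul, integral_rpow_neg_half]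
      _ = 2 * (M ^ 5)⁻¹ := by
          rw [Real.sqrt_sq hM0.le]
          field_simp
  -- `[M², S]`
  have h2 : ∫ s in M ^ 2..S, (max 1 s) ^ (-(1 / 2 : ℝ)) * ((max 1 s + M ^ 2) ^ 3)⁻¹ ≤
      (M ^ 5)⁻¹ / 8 := by
    have hMinv : (M ^ 2) ^ (-(1 / 2 : ℝ)) = M⁻¹ := by
      rw [Real.rpow_neg hM20.le, ← Real.sqrt_eq_rpow, Real.sqrt_sq hM0.le]
    have hcont2 : IntervalIntegrable (fun s : ℝ => M⁻¹ * ((s + M ^ 2) ^ 3)⁻¹) volume (M ^ 2) S := by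
      refine ContinuousOn.intervalIntegrable ?_
      rw [Set.uIcc_of_le hMS]
      refine continuousOn_const.mul (ContinuousOn.inv₀
        ((continuousOn_id.add continuousOn_const).pow 3) fun s hs => ?_)
      have : 0 < s + M ^ 2 := by linarith [hs.1]
      positivity
    calc _ ≤ ∫ s in M ^ 2..S, M⁻¹ * ((s + M ^ 2) ^ 3)⁻¹ := by
          refine intervalIntegral.integral_mono_on hMS (hcont.intervalIntegrable _ _) hcont2
            fun s hs => ?_
          have hs0 : 0 < s := hM20.trans_le hs.1
          have hrpow : (max 1 s) ^ (-(1 / 2 : ℝ)) ≤ M⁻¹ := by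
            rw [← hMinv]
            exact Real.rpow_le_rpow_of_nonpos hM20 (hs.1.trans (le_max_right _ _)) (by norm_num)
          have hcube : ((max 1 s + M ^ 2) ^ 3)⁻¹ ≤ ((s + M ^ 2) ^ 3)⁻¹ := by
            apply inv_anti₀ (by positivity)
            gcongr
            exact le_max_right _ _
          exact mul_le_mul hrpow hcube (by positivity) (by positivity)
      _ = M⁻¹ * ∫ s in M ^ 2..S, ((s + M ^ 2) ^ 3)⁻¹ := intervalIntegral.integral_const_mul _ _
      _ ≤ M⁻¹ * (((M ^ 2 + M ^ 2) ^ 2)⁻¹ / 2) := by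
          gcongr
          exact integral_inv_add_cube_le' (by positivity) hMS
      _ = (M ^ 5)⁻¹ / 8 := by
          field_simp
          ring
  have hM5 : 0 < (M ^ 5)⁻¹ := by positivity
  linarith

/-! ### The stub -/

/-- **Stub C — third differences of the four-torus Green function decay like `dist⁻⁵`, up to the
zero-mode background `L⁻⁴`.** There is an absolute constant `C` such that for all `L ≥ 1`, all
directions `i j k` and every `z ≠ 0` in `(ℤ/Lℤ)⁴`,
`|Hess_{ij}(z) - Hess_{ij}(z - e_k)| ≤ C (dist(0,z)⁻⁵ + L⁻⁴)`, where
`Hess_{ij}(z) = G̃_L(z+eᵢ) - G̃_L(z+eᵢ-eⱼ) - G̃_L(z) + G̃_L(z-eⱼ)`, `G̃_L = torusGreen` and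
`dist(0,z)² = ∑_μ z̃_μ²`, `z̃_μ = valMinAbs (z μ)` (heat-kernel chain of `TorusGreenHessianDecay`
with one more one-dimensional difference; tails `≤ C L⁻⁴` as there; cf. Lawler–Limic 2010, §6.3
for `ℤ^d`). [folklore] -/
theorem stub_torusGreenThirdDiff : ∃ C : ℝ, ∀ (L : ℕ) [NeZero L] (i j k : Fin 4)
    (z : TorusSite 4 L), z ≠ 0 →
      |(torusGreen (z + Pi.single i 1) - torusGreen (z + Pi.single i 1 - Pi.single j 1) -
            torusGreen (z) + torusGreen (z - Pi.single j 1)) -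
          (torusGreen ((z - Pi.single k 1 : TorusSite 4 L) + Pi.single i 1) -
            torusGreen ((z - Pi.single k 1 : TorusSite 4 L) + Pi.single i 1 - Pi.single j 1) -
            torusGreen ((z - Pi.single k 1 : TorusSite 4 L)) +
            torusGreen ((z - Pi.single k 1 : TorusSite 4 L) - Pi.single j 1))| ≤
        C * ((Real.sqrt (∑ μ, (((z μ).valMinAbs : ℤ) : ℝ) ^ 2) ^ 5)⁻¹ + ((L : ℝ) ^ 4)⁻¹) := by
  obtain ⟨K, hK, hP⟩ := abs_thirdDiff_hessian_prod_torusHeatKernel_le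
  set C₀ : ℝ := ∑' n : ℤ, (1 / 2 : ℝ) ^ n.natAbs with hC₀
  have hC₀0 : 0 ≤ C₀ := tsum_nonneg fun n => by positivity
  refine ⟨96 * K + π ^ 2 * C₀ ^ 4, ?_⟩
  intro L _ i j k z hz
  have hL : (0 : ℝ) < L := by exact_mod_cast Nat.pos_of_ne_zero (NeZero.ne L)
  -- the largest centred coordinate
  obtain ⟨μ₀, -, hμ₀⟩ := Finset.exists_max_image (univ : Finset (Fin 4))
    (fun μ => (z μ).valMinAbs.natAbs) Finset.univ_nonempty
  set M : ℝ := |((z μ₀).valMinAbs : ℝ)| with hM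
  have hMμ : ∀ μ, |((z μ).valMinAbs : ℝ)| ≤ M := fun μ => by
    have h := hμ₀ μ (Finset.mem_univ μ)
    rw [hM, ← Int.cast_abs, ← Int.cast_abs, ← Int.natCast_natAbs, ← Int.natCast_natAbs]
    exact_mod_cast h
  have hM1 : 1 ≤ M := by
    obtain ⟨μ₁, hμ₁⟩ : ∃ μ, z μ ≠ 0 := by
      by_contra h
      push Not at h
      exact hz (funext h)
    have h1 : (z μ₁).valMinAbs ≠ 0 := fun h => hμ₁ ((ZMod.valMinAbs_eq_zero _).1 h)
    have h2 : (1 : ℝ) ≤ |((z μ₁).valMinAbs : ℝ)| := by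
      rw [← Int.cast_abs]
      exact_mod_cast Int.one_le_abs h1
    exact h2.trans (hMμ μ₁)
  have hM0 : 0 < M := by linarith
  have hML : 2 * M ≤ L := by
    have h := two_mul_abs_valMinAbs_le (z μ₀)
    rw [hM, ← Int.cast_abs]
    exact_mod_cast h
  have hM2L : M ^ 2 ≤ (L : ℝ) ^ 2 := pow_le_pow_left₀ hM0.le (by linarith) 2
  -- the distance
  set D : ℝ := Real.sqrt (∑ μ, (((z μ).valMinAbs : ℤ) : ℝ) ^ 2) with hD
  have hDM : D ≤ 2 * M := by
    have hsum : ∑ μ, (((z μ).valMinAbs : ℤ) : ℝ) ^ 2 ≤ 4 * M ^ 2 := by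
      calc ∑ μ, (((z μ).valMinAbs : ℤ) : ℝ) ^ 2 ≤ ∑ _μ : Fin 4, M ^ 2 :=
            Finset.sum_le_sum fun μ _ => by
              rw [← sq_abs]
              exact pow_le_pow_left₀ (abs_nonneg _) (hMμ μ) 2
        _ = 4 * M ^ 2 := by simp
    calc D ≤ Real.sqrt (4 * M ^ 2) := Real.sqrt_le_sqrt hsum
      _ = 2 * M := by rw [show 4 * M ^ 2 = (2 * M) ^ 2 by ring, Real.sqrt_sq (by positivity)]
  have hMD : M ≤ D := by
    have h : M ^ 2 ≤ ∑ μ, (((z μ).valMinAbs : ℤ) : ℝ) ^ 2 := by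
      rw [hM, sq_abs]
      exact Finset.single_le_sum (f := fun μ => (((z μ).valMinAbs : ℤ) : ℝ) ^ 2)
        (fun μ _ => sq_nonneg _) (Finset.mem_univ μ₀)
    calc M = Real.sqrt (M ^ 2) := (Real.sqrt_sq hM0.le).symm
      _ ≤ D := Real.sqrt_le_sqrt h
  have hD0 : 0 < D := hM0.trans_le hMD
  have hD5 : (M ^ 5)⁻¹ ≤ 32 * (D ^ 5)⁻¹ := by
    rw [show 32 * (D ^ 5)⁻¹ = ((D / 2) ^ 5)⁻¹ by field_simp; ring]
    apply inv_anti₀ (by positivity)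
    exact pow_le_pow_left₀ (by positivity) (by linarith) 5
  -- the main term: time integral of the third difference of the product heat kernel
  have hS : (0 : ℝ) ≤ (L : ℝ) ^ 2 := by positivity
  have hmain : ∀ F : ℝ → ℝ, (∀ s ∈ Set.Ioc (0 : ℝ) ((L : ℝ) ^ 2),
      |F s| ≤ K * ((max 1 s) ^ (-(1 / 2 : ℝ)) * ((max 1 s + M ^ 2) ^ 3)⁻¹)) →
      |∫ s in (0 : ℝ)..(L : ℝ) ^ 2, F s| ≤ 3 * K * (M ^ 5)⁻¹ := by
    intro F hF
    have hcont : IntervalIntegrable (fun s : ℝ =>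
        K * ((max 1 s) ^ (-(1 / 2 : ℝ)) * ((max 1 s + M ^ 2) ^ 3)⁻¹)) volume 0 ((L : ℝ) ^ 2) :=
      (continuous_const.mul (continuous_thirdDiff_weight M)).intervalIntegrable _ _
    calc |∫ s in (0 : ℝ)..(L : ℝ) ^ 2, F s|
        ≤ ∫ s in (0 : ℝ)..(L : ℝ) ^ 2,
            K * ((max 1 s) ^ (-(1 / 2 : ℝ)) * ((max 1 s + M ^ 2) ^ 3)⁻¹) := by
          have h := intervalIntegral.norm_integral_le_of_norm_le hS
            (Filter.Eventually.of_forall fun s hs => (Real.norm_eq_abs _).le.trans (hF s hs)) hcont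
          rwa [Real.norm_eq_abs] at h
      _ = K * ∫ s in (0 : ℝ)..(L : ℝ) ^ 2,
            (max 1 s) ^ (-(1 / 2 : ℝ)) * ((max 1 s + M ^ 2) ^ 3)⁻¹ :=
          intervalIntegral.integral_const_mul _ _
      _ ≤ K * (3 * (M ^ 5)⁻¹) := by
          gcongr
          exact integral_thirdDiff_weight_le hM1 hM2L
      _ = 3 * K * (M ^ 5)⁻¹ := by ring
  -- the tails
  have ht1 := abs_torusGreen_hessian_tail_le z i j
  have ht2 := abs_torusGreen_hessian_tail_le (z - Pi.single k 1 : TorusSite 4 L) i j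
  rw [← hC₀] at ht1 ht2
  -- the Hessians: heat-kernel parts and tails at `S = L²`
  have hI : ∀ y : TorusSite 4 L,
      IntervalIntegrable (fun s : ℝ => ∏ μ, torusHeatKernel s (y μ)) volume 0 ((L : ℝ) ^ 2) :=
    fun y => (continuous_prod_torusHeatKernel y).intervalIntegrable _ _
  rw [torusGreen_hessian_eq z i j ((L : ℝ) ^ 2),
    torusGreen_hessian_eq (z - Pi.single k 1) i j ((L : ℝ) ^ 2), add_sub_add_comm,
    ← intervalIntegral.integral_sub ((((hI _).sub (hI _)).sub (hI _)).add (hI _))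
      ((((hI _).sub (hI _)).sub (hI _)).add (hI _))]
  refine (abs_add_le _ _).trans ?_
  refine (add_le_add (hmain _ fun s hs => ?_) ((abs_sub _ _).trans (add_le_add ht1 ht2))).trans ?_
  · simp only [Pi.add_apply, Pi.sub_apply]
    refine (hP L s hs.1 hs.2 z i j k μ₀).trans (le_of_eq ?_)
    rw [hM, sq_abs]
    ring
  · have e1 : π ^ 2 / 2 * C₀ ^ 4 / (L : ℝ) ^ 4 + π ^ 2 / 2 * C₀ ^ 4 / (L : ℝ) ^ 4 =
        π ^ 2 * C₀ ^ 4 * ((L : ℝ) ^ 4)⁻¹ := by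
      field_simp
      ring
    have h1 : 3 * K * (M ^ 5)⁻¹ ≤ 96 * K * (D ^ 5)⁻¹ := by nlinarith [hD5, hK]
    have h2 : 0 ≤ 96 * K * ((L : ℝ) ^ 4)⁻¹ := by positivity
    have h3 : 0 ≤ π ^ 2 * C₀ ^ 4 * (D ^ 5)⁻¹ := by positivity
    have e2 : (96 * K + π ^ 2 * C₀ ^ 4) * ((D ^ 5)⁻¹ + ((L : ℝ) ^ 4)⁻¹) =
        96 * K * (D ^ 5)⁻¹ + 96 * K * ((L : ℝ) ^ 4)⁻¹ + π ^ 2 * C₀ ^ 4 * (D ^ 5)⁻¹ +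
          π ^ 2 * C₀ ^ 4 * ((L : ℝ) ^ 4)⁻¹ := by ring
    linarith [e1, e2, h1, h2, h3]

end Summit.QuantumFields.YangMills.Theorems.SelfNormalisedSkewness.Negative
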